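import Mathlib
import HarnessLib

/-!
# Time doubling — crux stmt-NavierStokesRegularity-0056 (`TypeILiouville.TypeIliouvilleNoTypeII`), line Sketch (immortal zoom), stub stub_timeDoubling

Pure real analysis (no PDE): the doubling lemma of Poláčik–Quittner–Souplet (Indiana Univ.
Math. J. 56 (2007), Lemma 5.1) run on the TIME axis with the parabolic distance `√|s - t|`, in
the form the immortal zoom consumes. Let `m > 0` be continuous on `[a, T)` and suppose
`m(t) √(T - t)` is unbounded as `t ↑ T` (a "Type II" modulus). Then for every `k > 0` and every
`t₁ < T` there is a time `t ∈ (t₁, T)` with `k < m(t) √(T - t)` whose two-sided window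
`[t - k²/m(t)², t + k²/m(t)²]` lies in `(a, T)` and on which `m ≤ 2 m(t)`.

Proof. Pick a base time `y ∈ [a, T)` so late that `y - (T - y)/8 > max t₁ a`, with
`4 k < m(y) √(T - y)`, i.e. `r := k²/m(y)² < (T - y)/16`. If no good time existed, doubling
would fail at every admissible centre, and starting from `y` one could hop from a centre `x` to a
point `s` of its window with `m(s) > 2 m(x)`. The hop invariant `|x - y| ≤ 2 r - 2 k²/m(x)²` is
preserved (the radii shrink by a factor `4` at each hop) and makes every hop admissible
(`timeDoubling_admissible`), so all hops stay in the compact interval `[y - 2r, y + 2r] ⊂ [a, T)`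
where the continuous `m` is bounded, while `m` at least doubles at each hop — a contradiction.
No sequence is built: the hops are an `∃`-statement proved by induction on their number.
Everything here is Mathlib-only.
-/

-- the problem directory repeats the summit name (D-0017); core's `dupNamespace` linter fires
set_option linter.dupNamespace false

noncomputable section

open Set

namespace Summit.NavierStokesRegularity.NavierStokesRegularity.Theorems.TypeIliouvilleNoTypeII.ImmortalZoom

/-- Squaring a parabolic bound: `c < p √d` with `0 ≤ c`, `0 ≤ d` gives `c² < p² d`. -/
theorem sq_lt_sq_mul_of_lt_mul_sqrt {c p d : ℝ} (hc : 0 ≤ c) (hd : 0 ≤ d)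
    (h : c < p * Real.sqrt d) : c ^ 2 < p ^ 2 * d := by
  have h2 := pow_lt_pow_left₀ h hc two_ne_zero
  rwa [mul_pow, Real.sq_sqrt hd] at h2

/-- Un-squaring a parabolic bound: `c² < p² d` with `0 ≤ p`, `0 ≤ d` gives `c < p √d`. -/
theorem lt_mul_sqrt_of_sq_lt_sq_mul {c p d : ℝ} (hp : 0 ≤ p) (hd : 0 ≤ d)
    (h : c ^ 2 < p ^ 2 * d) : c < p * Real.sqrt d := by
  refine lt_of_pow_lt_pow_left₀ 2 (mul_nonneg hp (Real.sqrt_nonneg d)) ?_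
  rwa [mul_pow, Real.sq_sqrt hd]

/-- **Admissibility of the hop centres.** If the base time `y < T` has `16 k² < m(y)² (T - y)`
and is late (`8 t₁ + T < 9 y`, `8 a + T < 9 y`, i.e. `y - (T - y)/8 > t₁, a`), then every `x`
with `m y ≤ m x` obeying the hop invariant `|x - y| ≤ 2 k²/m(y)² - 2 k²/m(x)²` is an admissible
centre: `t₁ < x`, `k < m(x) √(T - x)`, and its window `[x - k²/m(x)², x + k²/m(x)²]` lies in
`(a, T)`. -/
theorem timeDoubling_admissible {m : ℝ → ℝ} {a T k t₁ y x : ℝ} (hk : 0 < k) (hmy : 0 < m y)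
    (hyT : y < T) (h16 : 16 * k ^ 2 < m y ^ 2 * (T - y)) (ht₁y : 8 * t₁ + T < 9 * y)
    (hay : 8 * a + T < 9 * y) (hyx : m y ≤ m x)
    (hdx : |x - y| ≤ 2 * (k ^ 2 / m y ^ 2) - 2 * (k ^ 2 / m x ^ 2)) :
    t₁ < x ∧ k < m x * Real.sqrt (T - x) ∧ a < x - k ^ 2 / m x ^ 2 ∧
      x + k ^ 2 / m x ^ 2 < T := by
  have hmx : 0 < m x := hmy.trans_le hyx
  have hTy : 0 < T - y := sub_pos.2 hyT
  have hP : 0 < m y ^ 2 * (T - y) := mul_pos (pow_pos hmy 2) hTy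
  have hr : k ^ 2 / m y ^ 2 < (T - y) / 16 := by
    rw [div_lt_iff₀ (by positivity)]
    linarith
  have hrx0 : 0 < k ^ 2 / m x ^ 2 := by positivity
  rw [abs_sub_le_iff] at hdx
  obtain ⟨hdx1, hdx2⟩ := hdx
  refine ⟨by linarith, ?_, by linarith, by linarith⟩
  have hsq : m y ^ 2 ≤ m x ^ 2 := pow_le_pow_left₀ hmy.le hyx 2
  have hTx : 7 * (T - y) / 8 < T - x := by linarith
  refine lt_mul_sqrt_of_sq_lt_sq_mul hmx.le (by linarith) ?_
  calc k ^ 2 < m y ^ 2 * (7 * (T - y) / 8) := by linarith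
    _ ≤ m x ^ 2 * (T - x) := mul_le_mul hsq hTx.le (by linarith) (by positivity)

/-- **Time doubling** (Poláčik–Quittner–Souplet 2007, Lemma 5.1, on the time axis with the
parabolic distance; stub `stub_timeDoubling` of line Sketch of the crux `TypeIliouvilleNoTypeII`).
If `m > 0` is continuous on `[a, T)` and `m(t) √(T - t)` is unbounded near `T`, then for every
`k > 0` and `t₁ < T` there is `t ∈ [a, T)`, `t > t₁`, with `k < m(t) √(T - t)`, whose window
`[t - k²/m(t)², t + k²/m(t)²]` lies in `(a, T)`, and with `m ≤ 2 m(t)` on that window. -/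
theorem stub_timeDoubling {m : ℝ → ℝ} {a T k : ℝ} (hk : 0 < k)
    (hm : ContinuousOn m (Ico a T)) (hpos : ∀ t ∈ Ico a T, 0 < m t)
    (hunb : ∀ K : ℝ, ∀ t₁ < T, ∃ t ∈ Ico a T, t₁ < t ∧ K < m t * Real.sqrt (T - t))
    (t₁ : ℝ) (ht₁ : t₁ < T) :
    ∃ t ∈ Ico a T, t₁ < t ∧ k < m t * Real.sqrt (T - t) ∧
      a < t - k ^ 2 / m t ^ 2 ∧ t + k ^ 2 / m t ^ 2 < T ∧
      ∀ s ∈ Icc (t - k ^ 2 / m t ^ 2) (t + k ^ 2 / m t ^ 2), m s ≤ 2 * m t := by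
  -- `a < T`: the interval `[a, T)` is nonempty by `hunb`
  obtain ⟨t₀, ht₀, -⟩ := hunb 0 t₁ ht₁
  have haT : a < T := ht₀.1.trans_lt ht₀.2
  -- a late base time `y` with `4 k < m y √(T - y)`
  have hbT : (8 * max t₁ a + T) / 9 < T := by
    have := max_lt ht₁ haT
    linarith
  obtain ⟨y, hy, hby, hKy⟩ := hunb (4 * k) _ hbT
  have ht₁y : 8 * t₁ + T < 9 * y := by linarith [le_max_left t₁ a]
  have hay : 8 * a + T < 9 * y := by linarith [le_max_right t₁ a]
  have hmy : 0 < m y := hpos y hy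
  have hTy : 0 < T - y := sub_pos.2 hy.2
  have h16 : 16 * k ^ 2 < m y ^ 2 * (T - y) :=
    calc 16 * k ^ 2 = (4 * k) ^ 2 := by ring
      _ < m y ^ 2 * (T - y) := sq_lt_sq_mul_of_lt_mul_sqrt (by positivity) hTy.le hKy
  have hr : k ^ 2 / m y ^ 2 < (T - y) / 16 := by
    rw [div_lt_iff₀ (by positivity)]
    linarith
  -- suppose no good time exists
  by_contra hno
  push Not at hno
  -- the hops: for every `n`, a centre obeying the hop invariant with `m ≥ 2 ^ n · m y`
  have key : ∀ n : ℕ, ∃ x ∈ Ico a T, (2 : ℝ) ^ n * m y ≤ m x ∧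
      |x - y| ≤ 2 * (k ^ 2 / m y ^ 2) - 2 * (k ^ 2 / m x ^ 2) := by
    intro n
    induction n with
    | zero => exact ⟨y, hy, by simp, by simp⟩
    | succ n ih =>
      obtain ⟨x, hx, hmx, hdx⟩ := ih
      have hyx : m y ≤ m x := by
        have h1 : (1 : ℝ) * m y ≤ 2 ^ n * m y :=
          mul_le_mul_of_nonneg_right (one_le_pow₀ (by norm_num)) hmy.le
        rw [one_mul] at h1
        exact h1.trans hmx
      have hmx0 : 0 < m x := hmy.trans_le hyx
      obtain ⟨h1, h2, h3, h4⟩ := timeDoubling_admissible hk hmy hy.2 h16 ht₁y hay hyx hdx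
      -- doubling fails at the admissible centre `x`: hop to `s`
      obtain ⟨s, hs, hms⟩ := hno x hx h1 h2 h3 h4
      have hms0 : 0 < m s := by linarith
      -- the new radius is at most a quarter of the old one
      have hrad : 4 * (k ^ 2 / m s ^ 2) ≤ k ^ 2 / m x ^ 2 := by
        have h2x : (0 : ℝ) ≤ 2 * m x := by positivity
        have h4sq : 4 * m x ^ 2 ≤ m s ^ 2 := by
          have := pow_le_pow_left₀ h2x hms.le 2
          linarith [show (2 * m x) ^ 2 = 4 * m x ^ 2 by ring]
        have hle : k ^ 2 / m s ^ 2 ≤ k ^ 2 / (4 * m x ^ 2) :=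
          div_le_div_of_nonneg_left (sq_nonneg k) (by positivity) h4sq
        have heq : k ^ 2 / (4 * m x ^ 2) = (k ^ 2 / m x ^ 2) / 4 := by ring
        linarith [hle.trans_eq heq]
      have hrs0 : 0 ≤ k ^ 2 / m s ^ 2 := by positivity
      refine ⟨s, ⟨by linarith [hs.1], by linarith [hs.2]⟩, ?_, ?_⟩
      · rw [pow_succ]
        linarith
      · rw [abs_sub_le_iff] at hdx ⊢
        obtain ⟨hdx1, hdx2⟩ := hdx
        exact ⟨by linarith [hs.2], by linarith [hs.1]⟩
  -- all hops stay in a compact interval inside `[a, T)`, on which `m` is bounded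
  have hJ : Icc (y - 2 * (k ^ 2 / m y ^ 2)) (y + 2 * (k ^ 2 / m y ^ 2)) ⊆ Ico a T :=
    fun z hz => ⟨by linarith [hz.1], by linarith [hz.2]⟩
  obtain ⟨B, hB⟩ := isCompact_Icc.exists_bound_of_continuousOn (hm.mono hJ)
  obtain ⟨n, hn⟩ := pow_unbounded_of_one_lt (B / m y) (by norm_num : (1 : ℝ) < 2)
  obtain ⟨x, -, hmx, hdx⟩ := key n
  have hxJ : x ∈ Icc (y - 2 * (k ^ 2 / m y ^ 2)) (y + 2 * (k ^ 2 / m y ^ 2)) := by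
    rw [abs_sub_le_iff] at hdx
    have : 0 ≤ k ^ 2 / m x ^ 2 := by positivity
    exact ⟨by linarith [hdx.2], by linarith [hdx.1]⟩
  have hmxB : m x ≤ B := by
    have := hB x hxJ
    rw [Real.norm_eq_abs] at this
    exact (le_abs_self _).trans this
  have h2n : (2 : ℝ) ^ n ≤ B / m y := by
    rw [le_div_iff₀ hmy]
    linarith
  linarith

end Summit.NavierStokesRegularity.NavierStokesRegularity.Theorems.TypeIliouvilleNoTypeII.ImmortalZoom
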